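import Mathlib

/-!
# Cell forgetting for the pair-carry chain (stub `stub_cellForget`)

The stub `stub_cellForget` of the crux `MobiusLadder.QuadraticDigitPhases`
(stmt-QuantumAdvantage-1391), line `Sketch`, with its lemmas.  Mathlib only.

For odd `p`, `q` and `k` input bits, the carry pair of `m ↦ (pm, qm)` after reading the `k` bits of
`T < 2^k`, started from the initial carries `(r, r') ∈ [0,p) × [0,q)`, is
`(⌊(pT + r)/2^k⌋, ⌊(qT + r')/2^k⌋)`.  It is independent of `(r, r')` for all but at most `p + q - 2`
of the `2^k` inputs `T`.

Proof: `⌊(pT + r)/2^k⌋ ≠ ⌊pT/2^k⌋` for some `r < p` forces `pT mod 2^k ≥ 2^k - (p - 1)`; since `p` is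
odd, `T ↦ pT mod 2^k` is injective on `[0, 2^k)`, so at most `#[2^k - (p-1), 2^k) ≤ p - 1` inputs are
bad for the first coordinate, and likewise `≤ q - 1` for the second; union bound.
-/

set_option linter.dupNamespace false -- D-0017: single-problem summit ⇒ `QuantumAdvantage.QuantumAdvantage` by design

namespace Summit.QuantumAdvantage.QuantumAdvantage.Theorems.MobiusLadderQuadraticDigitPhasesStubCellForget

open Finset

/-- If `a % c + b < c` then adding `b` to `a` does not change the quotient by `c`. -/
theorem add_div_eq_of_mod_add_lt {a b c : ℕ} (h : a % c + b < c) : (a + b) / c = a / c := by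
  have hc : 0 < c := by omega
  conv_lhs => rw [← Nat.div_add_mod a c, add_assoc, Nat.mul_add_div hc, Nat.div_eq_of_lt h, add_zero]

/-- Multiplication by an odd number, reduced modulo `2^k`, is injective on `range (2^k)`. -/
theorem injOn_mul_mod_two_pow {p : ℕ} (k : ℕ) (hp : Odd p) :
    Set.InjOn (fun T => p * T % 2 ^ k) (range (2 ^ k) : Set ℕ) := by
  intro T hT T' hT' h
  rw [coe_range, Set.mem_Iio] at hT hT'
  have hcop : Nat.Coprime (2 ^ k) p := ((Nat.coprime_two_right.mpr hp).pow_right k).symm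
  exact (Nat.ModEq.cancel_left_of_coprime hcop h).eq_of_lt_of_lt hT hT'

/-- One coordinate: for odd `p`, at most `p - 1` inputs `T < 2^k` have a final carry
`⌊(pT + r)/2^k⌋` depending on the initial carry `r < p`. -/
theorem card_filter_exists_div_ne_le {p : ℕ} (k : ℕ) (hp : Odd p) :
    ((range (2 ^ k)).filter (fun T => ∃ r ∈ range p, (p * T + r) / 2 ^ k ≠ p * T / 2 ^ k)).card
      ≤ p - 1 := by
  have hpos : 0 < 2 ^ k := Nat.two_pow_pos k
  calc ((range (2 ^ k)).filter (fun T => ∃ r ∈ range p, (p * T + r) / 2 ^ k ≠ p * T / 2 ^ k)).card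
      ≤ (Ico (2 ^ k - (p - 1)) (2 ^ k)).card := by
        refine card_le_card_of_injOn (fun T => p * T % 2 ^ k) (fun T hT => ?_)
          ((injOn_mul_mod_two_pow k hp).mono (coe_subset.mpr (filter_subset _ _)))
        rw [mem_coe, mem_filter] at hT
        obtain ⟨-, r, hr, hne⟩ := hT
        rw [mem_range] at hr
        simp only [mem_coe, mem_Ico]
        refine ⟨?_, Nat.mod_lt _ hpos⟩
        by_contra hlt
        exact hne (add_div_eq_of_mod_add_lt (by omega))
    _ = 2 ^ k - (2 ^ k - (p - 1)) := Nat.card_Ico _ _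
    _ ≤ p - 1 := by omega

/-- **Cell forgetting.**  For odd `p`, `q`, the carry pair `(⌊(pT + r)/2^k⌋, ⌊(qT + r')/2^k⌋)` after
`k` input bits is independent of the initial carries `(r, r') ∈ [0,p) × [0,q)` for all but at most
`p + q - 2` of the inputs `T < 2^k`. -/
theorem stub_cellForget :
    ∀ p q k : ℕ, Odd p → Odd q →
      ((Finset.range (2 ^ k)).filter (fun T => ∃ r ∈ Finset.range p, ∃ r' ∈ Finset.range q,
        ((p * T + r) / 2 ^ k ≠ p * T / 2 ^ k ∨ (q * T + r') / 2 ^ k ≠ q * T / 2 ^ k))).card ≤ p + q - 2 := by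
  intro p q k hp hq
  have hp1 : 1 ≤ p := hp.pos
  have hq1 : 1 ≤ q := hq.pos
  calc ((range (2 ^ k)).filter (fun T => ∃ r ∈ range p, ∃ r' ∈ range q,
        ((p * T + r) / 2 ^ k ≠ p * T / 2 ^ k ∨ (q * T + r') / 2 ^ k ≠ q * T / 2 ^ k))).card
      ≤ ((range (2 ^ k)).filter (fun T => ∃ r ∈ range p, (p * T + r) / 2 ^ k ≠ p * T / 2 ^ k) ∪
          (range (2 ^ k)).filter (fun T => ∃ r' ∈ range q, (q * T + r') / 2 ^ k ≠ q * T / 2 ^ k)).card := by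
        refine card_le_card (fun T hT => ?_)
        rw [mem_filter] at hT
        rw [mem_union, mem_filter, mem_filter]
        obtain ⟨hT, r, hr, r', hr', h | h⟩ := hT
        · exact Or.inl ⟨hT, r, hr, h⟩
        · exact Or.inr ⟨hT, r', hr', h⟩
    _ ≤ ((range (2 ^ k)).filter (fun T => ∃ r ∈ range p, (p * T + r) / 2 ^ k ≠ p * T / 2 ^ k)).card +
          ((range (2 ^ k)).filter (fun T => ∃ r' ∈ range q, (q * T + r') / 2 ^ k ≠ q * T / 2 ^ k)).card :=
        card_union_le _ _
    _ ≤ (p - 1) + (q - 1) :=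
        add_le_add (card_filter_exists_div_ne_le k hp) (card_filter_exists_div_ne_le k hq)
    _ = p + q - 2 := by omega

end Summit.QuantumAdvantage.QuantumAdvantage.Theorems.MobiusLadderQuadraticDigitPhasesStubCellForget
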